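import Summits.AtomisticToContinuum.FouriersLaw.Theorems.PhononMeanFreePathIncoherentChannelTimeResolvedBudget
import Summits.AtomisticToContinuum.FouriersLaw.Theorems.PhononMeanFreePathIncoherentChannelTimeReversal

/-!
# `IncoherentChannel`, line `two-horizons-forecast-loss` — the time-resolved forecast budget on `L²(μ₀)`

Helper file for crux `PhononMeanFreePath.IncoherentChannel` (item stmt-AtomisticToContinuum-11811, route
`PhononMeanFreePath`, sub-problem `FouriersLaw`). For the `(N+1)`-site pinned anharmonic chain
`P = pinnedChain ω₂ lam β γ` with both Langevin baths at `T` write `μ₀ = P.gibbsMeasure (N+1) T` (invariant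
probability) and `K_s = P.transitionKernel (N+1) T T s⁺` (Markov kernels). The tree proves the **time-resolved
forecast budget**

  `‖K_t F‖²_{L²(μ₀)} + (2γ/T) ∫_{0<s≤t} [(∫ p_0 K_s F dμ₀)² + (∫ p_N K_s F dμ₀)²] ds ≤ ‖F‖²_{L²(μ₀)}`

for `F ∈ C_c` (`forecastBudget_timeResolved_smooth_le`). This file extends it to EVERY measurable square-integrable
`F` (`forecastBudget_timeResolved_of_sq_integrable`, registered signature): density of `C_c^∞` in `L²(μ₀)`
(`stub_smoothDenseL2`), the `L²(μ₀)`-contraction of `K_s` on square-integrable data (Jensen under the Markov kernel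
plus the invariance `μ₀ K_s = μ₀`, here for `lam ≥ 0`), hence `K_s F_k → K_s F` in `L²(μ₀)` for every `s`,
convergence of the four terms (Cauchy–Schwarz against `p_0, p_N ∈ L²(μ₀)` for the two correlations), Fatou in `s`
on the finite window and super-additivity of `liminf`. The lead applies it to `F = K_{t₁} p_N` (TAIL budget).
No definitions; nothing here closes an item.
-/

noncomputable section

namespace Summit.AtomisticToContinuum.FouriersLaw.Theorems.PhononMeanFreePath

open MeasureTheory ProbabilityTheory Set Filter Topology
open scoped NNReal ENNReal
open Literature.MathematicalPhysics.KineticTheory.HeatConduction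
open Literature.MathematicalPhysics.KineticTheory Literature.Probability.Process OscillatorChain
open Summit.AtomisticToContinuum.FouriersLaw.Theorems.IncoherentBounded
open Summit.AtomisticToContinuum.FouriersLaw.Theorems.SubdiffusiveBondHeat

/-! ### Two elementary `L²` convergence tools -/

/-- **Continuity of `∫ g² dμ` along an `L²(μ)`-convergent sequence**: if `∫ (g_k - h)² dμ → 0` for
square-integrable `g_k, h`, then `∫ g_k² dμ → ∫ h² dμ`
(`∫ g_k² - ∫ h² = ∫ (g_k - h)² + 2 ∫ (g_k - h) h` and Cauchy–Schwarz). [folklore] -/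
theorem semigroupBudget_tendsto_integral_sq {n : ℕ} {μ : Measure (PhaseSpace n)} {g : ℕ → PhaseSpace n → ℝ}
    {h : PhaseSpace n → ℝ} (hgm : ∀ k, AEStronglyMeasurable (g k) μ) (hhm : AEStronglyMeasurable h μ)
    (hg2 : ∀ k, Integrable (fun x => g k x ^ 2) μ) (hh2 : Integrable (fun x => h x ^ 2) μ)
    (hd : Tendsto (fun k => ∫ x, (g k x - h x) ^ 2 ∂μ) atTop (𝓝 0)) :
    Tendsto (fun k => ∫ x, g k x ^ 2 ∂μ) atTop (𝓝 (∫ x, h x ^ 2 ∂μ)) := by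
  have hd2 : ∀ k, Integrable (fun x => (g k x - h x) ^ 2) μ := fun k =>
    (memLp_two_iff_integrable_sq ((hgm k).sub hhm)).1
      (((memLp_two_iff_integrable_sq (hgm k)).2 (hg2 k)).sub ((memLp_two_iff_integrable_sq hhm).2 hh2))
  have hprod : ∀ k, Integrable (fun x => (g k x - h x) * h x) μ := fun k =>
    integrable_mul_of_sq_aesm ((hgm k).sub hhm) hhm (hd2 k) hh2
  -- `∫ g_k² - ∫ h² = ∫ (g_k - h)² + 2 ∫ (g_k - h) h`
  have hid : ∀ k, (∫ x, g k x ^ 2 ∂μ) - ∫ x, h x ^ 2 ∂μ =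
      (∫ x, (g k x - h x) ^ 2 ∂μ) + 2 * ∫ x, (g k x - h x) * h x ∂μ := by
    intro k
    rw [← integral_sub (hg2 k) hh2, ← integral_const_mul, ← integral_add (hd2 k) ((hprod k).const_mul 2)]
    refine integral_congr_ae (Eventually.of_forall fun x => ?_)
    ring
  have hcs : ∀ k, |∫ x, (g k x - h x) * h x ∂μ| ≤ Real.sqrt ((∫ x, (g k x - h x) ^ 2 ∂μ) * ∫ x, h x ^ 2 ∂μ) := by
    intro k
    rw [← Real.sqrt_sq_eq_abs]
    exact Real.sqrt_le_sqrt (timeReversal_sq_integral_mul_le (hd2 k) hh2)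
  have hbound : ∀ k, ‖(∫ x, g k x ^ 2 ∂μ) - ∫ x, h x ^ 2 ∂μ‖ ≤
      (∫ x, (g k x - h x) ^ 2 ∂μ) + 2 * Real.sqrt ((∫ x, (g k x - h x) ^ 2 ∂μ) * ∫ x, h x ^ 2 ∂μ) := by
    intro k
    rw [Real.norm_eq_abs, hid k]
    have h0 : 0 ≤ ∫ x, (g k x - h x) ^ 2 ∂μ := integral_nonneg fun x => sq_nonneg _
    obtain ⟨h1, h2⟩ := abs_le.1 (hcs k)
    rw [abs_le]
    constructor <;> linarith
  have hlim : Tendsto (fun k => (∫ x, (g k x - h x) ^ 2 ∂μ) +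
      2 * Real.sqrt ((∫ x, (g k x - h x) ^ 2 ∂μ) * ∫ x, h x ^ 2 ∂μ)) atTop (𝓝 0) := by
    have := hd.add (((hd.mul_const (∫ x, h x ^ 2 ∂μ)).sqrt).const_mul 2)
    simpa using this
  have := (squeeze_zero_norm hbound hlim).add_const (∫ x, h x ^ 2 ∂μ)
  simpa using this

/-- **Weak convergence against a square-integrable weight along an `L²(μ)`-convergent sequence**: if
`∫ (g_k - h)² dμ → 0` for square-integrable `g_k, h` and `w² ∈ L¹(μ)`, then `∫ w g_k dμ → ∫ w h dμ`
(Cauchy–Schwarz: `|∫ w (g_k - h)| ≤ √(∫ w²) √(∫ (g_k - h)²)`). [folklore] -/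
theorem semigroupBudget_tendsto_integral_mul {n : ℕ} {μ : Measure (PhaseSpace n)} {g : ℕ → PhaseSpace n → ℝ}
    {h w : PhaseSpace n → ℝ} (hgm : ∀ k, AEStronglyMeasurable (g k) μ) (hhm : AEStronglyMeasurable h μ)
    (hwm : AEStronglyMeasurable w μ) (hg2 : ∀ k, Integrable (fun x => g k x ^ 2) μ)
    (hh2 : Integrable (fun x => h x ^ 2) μ) (hw2 : Integrable (fun x => w x ^ 2) μ)
    (hd : Tendsto (fun k => ∫ x, (g k x - h x) ^ 2 ∂μ) atTop (𝓝 0)) :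
    Tendsto (fun k => ∫ x, w x * g k x ∂μ) atTop (𝓝 (∫ x, w x * h x ∂μ)) := by
  have hd2 : ∀ k, Integrable (fun x => (g k x - h x) ^ 2) μ := fun k =>
    (memLp_two_iff_integrable_sq ((hgm k).sub hhm)).1
      (((memLp_two_iff_integrable_sq (hgm k)).2 (hg2 k)).sub ((memLp_two_iff_integrable_sq hhm).2 hh2))
  have i1 : ∀ k, Integrable (fun x => w x * g k x) μ := fun k => integrable_mul_of_sq_aesm hwm (hgm k) hw2 (hg2 k)
  have i2 : Integrable (fun x => w x * h x) μ := integrable_mul_of_sq_aesm hwm hhm hw2 hh2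
  have hid : ∀ k, (∫ x, w x * g k x ∂μ) - ∫ x, w x * h x ∂μ = ∫ x, w x * (g k x - h x) ∂μ := by
    intro k
    rw [← integral_sub (i1 k) i2]
    refine integral_congr_ae (Eventually.of_forall fun x => ?_)
    ring
  have hbound : ∀ k, ‖(∫ x, w x * g k x ∂μ) - ∫ x, w x * h x ∂μ‖ ≤
      Real.sqrt ((∫ x, w x ^ 2 ∂μ) * ∫ x, (g k x - h x) ^ 2 ∂μ) := by
    intro k
    rw [Real.norm_eq_abs, hid k, ← Real.sqrt_sq_eq_abs]
    exact Real.sqrt_le_sqrt (timeReversal_sq_integral_mul_le hw2 (hd2 k))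
  have hlim : Tendsto (fun k => Real.sqrt ((∫ x, w x ^ 2 ∂μ) * ∫ x, (g k x - h x) ^ 2 ∂μ)) atTop (𝓝 0) := by
    have := (hd.const_mul (∫ x, w x ^ 2 ∂μ)).sqrt
    simpa using this
  have := (squeeze_zero_norm hbound hlim).add_const (∫ x, w x * h x ∂μ)
  simpa using this

/-! ### The `L²(μ₀)`-contraction of the equilibrium kernels for `lam ≥ 0` -/

section Contraction

variable {ω₂ lam β γ : ℝ} (hω : 0 < ω₂) (hl : 0 ≤ lam) (hβ : 0 < β) (hγ : 0 < γ) {T : ℝ} (hT : 0 < T) (N : ℕ)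
include hω hl hβ hγ hT

/-- **`L²(μ₀)`-contraction of `K_u` on square-integrable observables** of the `(N+1)`-site chain, for `lam ≥ 0`:
for measurable `g` with `g² ∈ L¹(μ₀)`, for `μ₀`-a.e. `z` both `g` and `g²` are `K_u(z,·)`-integrable,
`(K_u g)² ∈ L¹(μ₀)` and `∫ (K_u g)² dμ₀ ≤ ∫ g² dμ₀` (Jensen under the Markov kernel and the invariance
`μ₀ K_u = μ₀`, `pinnedChain_gibbsMeasure_bind_transitionKernel`).
(adapted from `SubdiffusiveBondHeat.pinnedChain_sq_act_le_of_sq_integrable`, stated there for `lam > 0`) [folklore] -/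
theorem semigroupBudget_sq_act_le {g : PhaseSpace (N + 1) → ℝ} (hgm : Measurable g)
    (hg2 : Integrable (fun y => g y ^ 2) ((pinnedChain ω₂ lam β γ).gibbsMeasure (N + 1) T)) (u : ℝ≥0) :
    (∀ᵐ z ∂((pinnedChain ω₂ lam β γ).gibbsMeasure (N + 1) T),
        Integrable g (((pinnedChain ω₂ lam β γ).transitionKernel (N + 1) T T u) z) ∧
        Integrable (fun y => g y ^ 2) (((pinnedChain ω₂ lam β γ).transitionKernel (N + 1) T T u) z)) ∧
    Integrable (fun z => (∫ y, g y ∂(((pinnedChain ω₂ lam β γ).transitionKernel (N + 1) T T u) z)) ^ 2)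
      ((pinnedChain ω₂ lam β γ).gibbsMeasure (N + 1) T) ∧
    ∫ z, (∫ y, g y ∂(((pinnedChain ω₂ lam β γ).transitionKernel (N + 1) T T u) z)) ^ 2
        ∂((pinnedChain ω₂ lam β γ).gibbsMeasure (N + 1) T) ≤
      ∫ z, g z ^ 2 ∂((pinnedChain ω₂ lam β γ).gibbsMeasure (N + 1) T) := by
  -- adapted from `pinnedChain_sq_act_le_of_sq_integrable` (file `…SubdiffusiveBondHeatKernelDetailedBalance`)
  have hN : 0 < N + 1 := Nat.succ_pos N
  set μ := (pinnedChain ω₂ lam β γ).gibbsMeasure (N + 1) T with hμ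
  set κ := (pinnedChain ω₂ lam β γ).transitionKernel (N + 1) T T u with hκ
  haveI : IsProbabilityMeasure μ := pinnedChain_isProbabilityMeasure_gibbsMeasure hω hl hβ.le γ (N + 1) hT
  haveI : IsMarkovKernel κ := pinnedChain_isMarkovKernel_transitionKernel hω hl hβ.le hγ.le (N + 1) T T u
  have hinv : κ ∘ₘ μ = μ := pinnedChain_gibbsMeasure_bind_transitionKernel hω hl hβ.le hγ.le hN hT u
  have hg2c : Integrable (fun y => g y ^ 2) (κ ∘ₘ μ) := by rw [hinv]; exact hg2
  have hcomp := (Measure.integrable_comp_iff hg2c.aestronglyMeasurable).1 hg2c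
  have hae2 : ∀ᵐ z ∂μ, Integrable (fun y => g y ^ 2) (κ z) := hcomp.1
  have hae1 : ∀ᵐ z ∂μ, Integrable g (κ z) := by
    filter_upwards [hae2] with z hz
    exact ((memLp_two_iff_integrable_sq hgm.aestronglyMeasurable).2 hz).integrable one_le_two
  have hP2int : Integrable (fun z => ∫ y, g y ^ 2 ∂(κ z)) μ := by
    refine hcomp.2.congr (Eventually.of_forall fun z => ?_)
    refine integral_congr_ae (Eventually.of_forall fun y => ?_)
    simp only [Real.norm_eq_abs, abs_pow, sq_abs]
  have hP2val : ∫ z, (∫ y, g y ^ 2 ∂(κ z)) ∂μ = ∫ z, g z ^ 2 ∂μ :=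
    pinnedChain_integral_transitionKernel_gibbsMeasure hω hl hβ.le hγ.le hN hT u hg2
  have hGm : StronglyMeasurable fun z => ∫ y, g y ∂(κ z) := hgm.stronglyMeasurable.integral_kernel (κ := κ)
  have hjensen : ∀ᵐ z ∂μ, (∫ y, g y ∂(κ z)) ^ 2 ≤ ∫ y, g y ^ 2 ∂(κ z) := by
    filter_upwards [hae1, hae2] with z h1 h2
    have hvar : 0 ≤ ∫ y, (g y - ∫ y', g y' ∂(κ z)) ^ 2 ∂(κ z) := integral_nonneg fun y => sq_nonneg _
    have hexp : ∫ y, (g y - ∫ y', g y' ∂(κ z)) ^ 2 ∂(κ z) = (∫ y, g y ^ 2 ∂(κ z)) - (∫ y, g y ∂(κ z)) ^ 2 := by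
      have e : (fun y => (g y - ∫ y', g y' ∂(κ z)) ^ 2) =
          fun y => g y ^ 2 - (2 * ∫ y', g y' ∂(κ z)) * g y + (∫ y', g y' ∂(κ z)) ^ 2 := by
        funext y; ring
      have i1 : Integrable (fun y => g y ^ 2 - (2 * ∫ y', g y' ∂(κ z)) * g y) (κ z) := h2.sub (h1.const_mul _)
      rw [e, integral_add i1 (integrable_const _), integral_sub h2 (h1.const_mul _), integral_const_mul,
        integral_const]
      simp only [probReal_univ, smul_eq_mul, one_mul]
      ring
    linarith
  have hG2int : Integrable (fun z => (∫ y, g y ∂(κ z)) ^ 2) μ :=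
    hP2int.mono' (hGm.measurable.pow_const 2).aestronglyMeasurable (by
      filter_upwards [hjensen] with z hz
      rw [Real.norm_eq_abs, abs_of_nonneg (sq_nonneg _)]; exact hz)
  refine ⟨?_, hG2int, ?_⟩
  · filter_upwards [hae1, hae2] with z h1 h2
    exact ⟨h1, h2⟩
  · rw [← hP2val]
    exact integral_mono_ae hG2int hP2int hjensen

/-! ### The time-resolved budget for a square-integrable observable -/

/-- **The time-resolved two-sided coherent bound on `L²(μ₀)`** (section form of
`forecastBudget_timeResolved_of_sq_integrable`): for measurable `F` with `F² ∈ L¹(μ₀)` and `t > 0`,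

  `‖K_t F‖²_{L²(μ₀)} + (2γ/T) ∫_{0<s≤t} [(∫ p_0 K_s F dμ₀)² + (∫ p_N K_s F dμ₀)²] ds ≤ ∫ F² dμ₀`.

Approximate `F` in `L²(μ₀)` by `F_k ∈ C_c^∞` (`stub_smoothDenseL2`), apply `forecastBudget_timeResolved_smooth_le`
to each `F_k`, and pass to the limit: `K_s F_k → K_s F` in `L²(μ₀)` for every `s` (`semigroupBudget_sq_act_le` on
`F_k - F`), so the forecast norm and `∫ F_k²` converge and both correlations converge for every `s`; Fatou in `s`
and `liminf A_k + liminf B_k ≤ liminf (A_k + B_k)`. [folklore] -/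
theorem forecastBudget_timeResolved_of_sq_integrable' {F : PhaseSpace (N + 1) → ℝ} (hFm : Measurable F)
    (hF2 : Integrable (fun z => F z ^ 2) ((pinnedChain ω₂ lam β γ).gibbsMeasure (N + 1) T)) {t : ℝ}
    (ht : 0 < t) :
    ENNReal.ofReal (∫ x, (∫ y, F y ∂((pinnedChain ω₂ lam β γ).transitionKernel (N + 1) T T t.toNNReal x)) ^ 2
        ∂((pinnedChain ω₂ lam β γ).gibbsMeasure (N + 1) T)) +
      ENNReal.ofReal (2 * γ / T) * ∫⁻ s in Ioc (0 : ℝ) t, (ENNReal.ofReal ((∫ x, x.2 0 *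
        (∫ y, F y ∂((pinnedChain ω₂ lam β γ).transitionKernel (N + 1) T T s.toNNReal x))
          ∂((pinnedChain ω₂ lam β γ).gibbsMeasure (N + 1) T)) ^ 2) +
      ENNReal.ofReal ((∫ x, x.2 (Fin.last N) *
        (∫ y, F y ∂((pinnedChain ω₂ lam β γ).transitionKernel (N + 1) T T s.toNNReal x))
          ∂((pinnedChain ω₂ lam β γ).gibbsMeasure (N + 1) T)) ^ 2)) ≤
      ENNReal.ofReal (∫ x, F x ^ 2 ∂((pinnedChain ω₂ lam β γ).gibbsMeasure (N + 1) T)) := by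
  set P := pinnedChain ω₂ lam β γ with hP
  set μ := P.gibbsMeasure (N + 1) T with hμ
  haveI : IsProbabilityMeasure μ := pinnedChain_isProbabilityMeasure_gibbsMeasure hω hl hβ.le γ (N + 1) hT
  haveI : ∀ u, IsMarkovKernel (P.transitionKernel (N + 1) T T u) := fun u =>
    pinnedChain_isMarkovKernel_transitionKernel hω hl hβ.le hγ.le (N + 1) T T u
  have hFL : MemLp F 2 μ := (memLp_two_iff_integrable_sq hFm.aestronglyMeasurable).2 hF2
  -- (1) density of `C_c^∞` in `L²(μ₀)`
  have hdense : ∀ k : ℕ, ∃ φ : PhaseSpace (N + 1) → ℝ, ContDiff ℝ ((⊤ : ℕ∞) : WithTop ℕ∞) φ ∧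
      HasCompactSupport φ ∧ ∫ x, (F x - φ x) ^ 2 ∂μ ≤ 1 / ((k : ℝ) + 1) := fun k =>
    stub_smoothDenseL2 (N + 1) μ F hFL _ (by positivity)
  choose φ hφs hφc hφd using hdense
  have hφcont : ∀ k, Continuous (φ k) := fun k => (hφs k).continuous
  have hφm : ∀ k, Measurable (φ k) := fun k => (hφcont k).measurable
  have hφ2 : ∀ k, Integrable (fun x => φ k x ^ 2) μ := fun k =>
    ((hφcont k).memLp_of_hasCompactSupport (hφc k)).integrable_sq
  have hdm : ∀ k, Measurable fun x => φ k x - F x := fun k => (hφm k).sub hFm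
  have hd2 : ∀ k, Integrable (fun x => (φ k x - F x) ^ 2) μ := fun k =>
    (memLp_two_iff_integrable_sq (hdm k).aestronglyMeasurable).1
      (((hφcont k).memLp_of_hasCompactSupport (hφc k)).sub hFL)
  -- the `L²(μ₀)` distances `D k = ∫ (F_k - F)² dμ₀ → 0`
  set D : ℕ → ℝ := fun k => ∫ x, (φ k x - F x) ^ 2 ∂μ with hD
  have hDle : ∀ k, D k ≤ 1 / ((k : ℝ) + 1) := by
    intro k
    refine le_of_eq_of_le (integral_congr_ae (Eventually.of_forall fun x => ?_)) (hφd k)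
    show (φ k x - F x) ^ 2 = (F x - φ k x) ^ 2
    ring
  have hD0 : Tendsto D atTop (𝓝 0) :=
    squeeze_zero (fun k => integral_nonneg fun x => sq_nonneg _) hDle tendsto_one_div_add_atTop_nhds_zero_nat
  -- (2) the forecasts `U u = K_u F`, `V k u = K_u F_k`
  set U : ℝ≥0 → PhaseSpace (N + 1) → ℝ := fun u z => ∫ y, F y ∂(P.transitionKernel (N + 1) T T u z) with hU
  set V : ℕ → ℝ≥0 → PhaseSpace (N + 1) → ℝ := fun k u z =>
    ∫ y, φ k y ∂(P.transitionKernel (N + 1) T T u z) with hV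
  have hUm : ∀ u, Measurable (U u) := fun u =>
    (hFm.stronglyMeasurable.integral_kernel (κ := P.transitionKernel (N + 1) T T u)).measurable
  have hVm : ∀ k u, Measurable (V k u) := fun k u =>
    ((hφm k).stronglyMeasurable.integral_kernel (κ := P.transitionKernel (N + 1) T T u)).measurable
  have hFK := fun u => semigroupBudget_sq_act_le hω hl hβ hγ hT N hFm hF2 u
  have hU2 : ∀ u, Integrable (fun z => U u z ^ 2) μ := fun u => (hFK u).2.1
  have hV2 : ∀ k u, Integrable (fun z => V k u z ^ 2) μ := fun k u =>
    (semigroupBudget_sq_act_le hω hl hβ hγ hT N (hφm k) (hφ2 k) u).2.1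
  -- a.e. linearity `V k u - U u = K_u (F_k - F)` and the `L²(μ₀)`-convergence `V k u → U u`
  have hlin : ∀ k u, ∀ᵐ z ∂μ, V k u z - U u z = ∫ y, (φ k y - F y) ∂(P.transitionKernel (N + 1) T T u z) := by
    intro k u
    filter_upwards [(hFK u).1] with z hz
    exact (integral_sub ((hφcont k).integrable_of_hasCompactSupport (hφc k)) hz.1).symm
  have hE : ∀ k u, ∫ z, (V k u z - U u z) ^ 2 ∂μ ≤ D k := by
    intro k u
    calc ∫ z, (V k u z - U u z) ^ 2 ∂μ
        = ∫ z, (∫ y, (φ k y - F y) ∂(P.transitionKernel (N + 1) T T u z)) ^ 2 ∂μ := by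
          refine integral_congr_ae ?_
          filter_upwards [hlin k u] with z hz
          rw [hz]
      _ ≤ D k := (semigroupBudget_sq_act_le hω hl hβ hγ hT N (hdm k) (hd2 k) u).2.2
  have hE0 : ∀ u, Tendsto (fun k => ∫ z, (V k u z - U u z) ^ 2 ∂μ) atTop (𝓝 0) := fun u =>
    squeeze_zero (fun k => integral_nonneg fun z => sq_nonneg _) (fun k => hE k u) hD0
  -- (3a) the forecast-norm term and the right-hand side converge
  have hA : Tendsto (fun k => ∫ z, V k t.toNNReal z ^ 2 ∂μ) atTop (𝓝 (∫ z, U t.toNNReal z ^ 2 ∂μ)) :=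
    semigroupBudget_tendsto_integral_sq (fun k => (hVm k _).aestronglyMeasurable) (hUm _).aestronglyMeasurable
      (fun k => hV2 k _) (hU2 _) (hE0 _)
  have hR : Tendsto (fun k => ∫ z, φ k z ^ 2 ∂μ) atTop (𝓝 (∫ z, F z ^ 2 ∂μ)) :=
    semigroupBudget_tendsto_integral_sq (fun k => (hφm k).aestronglyMeasurable) hFm.aestronglyMeasurable
      hφ2 hF2 hD0
  -- (3b) both correlations converge for every `s`
  set ck : Fin (N + 1) → ℕ → ℝ → ℝ := fun j k s => ∫ z, z.2 j * V k s.toNNReal z ∂μ with hck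
  set c : Fin (N + 1) → ℝ → ℝ := fun j s => ∫ z, z.2 j * U s.toNNReal z ∂μ with hc
  have hck_meas : ∀ j k, Measurable (ck j k) := fun j k =>
    measurable_corr hω hl hβ hγ hT (f := fun z : PhaseSpace (N + 1) => z.2 j) (by fun_prop) (hφcont k)
  have hout : ∀ (j : Fin (N + 1)) (s : ℝ), Tendsto (fun k => ck j k s) atTop (𝓝 (c j s)) := fun j s =>
    semigroupBudget_tendsto_integral_mul (fun k => (hVm k _).aestronglyMeasurable) (hUm _).aestronglyMeasurable
      (by fun_prop : Measurable fun z : PhaseSpace (N + 1) => z.2 j).aestronglyMeasurable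
      (fun k => hV2 k _) (hU2 _) (lightCone_integrable_momentum_pow hω hl hβ.le hT j 2) (hE0 _)
  -- (4a) the forecast-norm term
  have hAterm : ENNReal.ofReal (∫ z, U t.toNNReal z ^ 2 ∂μ) ≤
      liminf (fun k => ENNReal.ofReal (∫ z, V k t.toNNReal z ^ 2 ∂μ)) atTop :=
    ((ENNReal.tendsto_ofReal hA).liminf_eq).ge
  -- (4b) the channel term: Fatou in `s`
  set Bk : ℕ → ℝ → ℝ≥0∞ := fun k s => ENNReal.ofReal (2 * γ / T) *
    (ENNReal.ofReal (ck 0 k s ^ 2) + ENNReal.ofReal (ck (Fin.last N) k s ^ 2)) with hBk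
  have hBk_meas : ∀ k, Measurable (Bk k) := fun k =>
    ((((hck_meas 0 k).pow_const 2).ennreal_ofReal).add
      (((hck_meas (Fin.last N) k).pow_const 2).ennreal_ofReal)).const_mul _
  have hBlim : ∀ s, liminf (fun k => Bk k s) atTop =
      ENNReal.ofReal (2 * γ / T) * (ENNReal.ofReal (c 0 s ^ 2) + ENNReal.ofReal (c (Fin.last N) s ^ 2)) := by
    intro s
    refine Tendsto.liminf_eq ?_
    exact ENNReal.Tendsto.const_mul ((ENNReal.tendsto_ofReal ((hout 0 s).pow 2)).add
      (ENNReal.tendsto_ofReal ((hout (Fin.last N) s).pow 2))) (Or.inr ENNReal.ofReal_ne_top)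
  have hBterm : ENNReal.ofReal (2 * γ / T) * ∫⁻ s in Ioc (0 : ℝ) t,
      (ENNReal.ofReal (c 0 s ^ 2) + ENNReal.ofReal (c (Fin.last N) s ^ 2)) ≤
      liminf (fun k => ENNReal.ofReal (2 * γ / T) * ∫⁻ s in Ioc (0 : ℝ) t,
        (ENNReal.ofReal (ck 0 k s ^ 2) + ENNReal.ofReal (ck (Fin.last N) k s ^ 2))) atTop := by
    calc ENNReal.ofReal (2 * γ / T) * ∫⁻ s in Ioc (0 : ℝ) t,
          (ENNReal.ofReal (c 0 s ^ 2) + ENNReal.ofReal (c (Fin.last N) s ^ 2))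
        = ∫⁻ s in Ioc (0 : ℝ) t, ENNReal.ofReal (2 * γ / T) *
            (ENNReal.ofReal (c 0 s ^ 2) + ENNReal.ofReal (c (Fin.last N) s ^ 2)) :=
          (lintegral_const_mul' _ _ ENNReal.ofReal_ne_top).symm
      _ = ∫⁻ s in Ioc (0 : ℝ) t, liminf (fun k => Bk k s) atTop := lintegral_congr fun s => (hBlim s).symm
      _ ≤ liminf (fun k => ∫⁻ s in Ioc (0 : ℝ) t, Bk k s) atTop := lintegral_liminf_le hBk_meas
      _ = liminf (fun k => ENNReal.ofReal (2 * γ / T) * ∫⁻ s in Ioc (0 : ℝ) t,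
            (ENNReal.ofReal (ck 0 k s ^ 2) + ENNReal.ofReal (ck (Fin.last N) k s ^ 2))) atTop :=
          Filter.liminf_congr (Eventually.of_forall fun k => lintegral_const_mul' _ _ ENNReal.ofReal_ne_top)
  -- (4c) the budget of each approximant, and superadditivity of `liminf`
  have hk_bound : ∀ k, ENNReal.ofReal (∫ z, V k t.toNNReal z ^ 2 ∂μ) + ENNReal.ofReal (2 * γ / T) *
      ∫⁻ s in Ioc (0 : ℝ) t, (ENNReal.ofReal (ck 0 k s ^ 2) + ENNReal.ofReal (ck (Fin.last N) k s ^ 2)) ≤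
      ENNReal.ofReal (∫ z, φ k z ^ 2 ∂μ) := fun k =>
    forecastBudget_timeResolved_smooth_le hω hl hβ hγ hT N (hφcont k) (hφc k) ht
  calc ENNReal.ofReal (∫ z, U t.toNNReal z ^ 2 ∂μ) + ENNReal.ofReal (2 * γ / T) * ∫⁻ s in Ioc (0 : ℝ) t,
        (ENNReal.ofReal (c 0 s ^ 2) + ENNReal.ofReal (c (Fin.last N) s ^ 2))
      ≤ liminf (fun k => ENNReal.ofReal (∫ z, V k t.toNNReal z ^ 2 ∂μ)) atTop +
          liminf (fun k => ENNReal.ofReal (2 * γ / T) * ∫⁻ s in Ioc (0 : ℝ) t,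
            (ENNReal.ofReal (ck 0 k s ^ 2) + ENNReal.ofReal (ck (Fin.last N) k s ^ 2))) atTop :=
        add_le_add hAterm hBterm
    _ ≤ liminf (fun k => ENNReal.ofReal (∫ z, V k t.toNNReal z ^ 2 ∂μ) + ENNReal.ofReal (2 * γ / T) *
          ∫⁻ s in Ioc (0 : ℝ) t, (ENNReal.ofReal (ck 0 k s ^ 2) + ENNReal.ofReal (ck (Fin.last N) k s ^ 2)))
            atTop :=
        add_liminf_le_liminf_add _ _
    _ ≤ liminf (fun k => ENNReal.ofReal (∫ z, φ k z ^ 2 ∂μ)) atTop :=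
        liminf_le_liminf (Eventually.of_forall hk_bound)
    _ = ENNReal.ofReal (∫ z, F z ^ 2 ∂μ) := (ENNReal.tendsto_ofReal hR).liminf_eq

end Contraction

/-- **THE TIME-RESOLVED FORECAST BUDGET ON `L²(μ₀)`** (registered helper of line `two-horizons-forecast-loss`):
for the pinned anharmonic chain (`ω₂, β, γ > 0`, `lam ≥ 0`) with both baths at `T > 0`, EVERY `N`, every
measurable `F` with `∫ F² dμ₀ < ∞` and every horizon `t > 0`,

  `‖K_t F‖²_{L²(μ₀)} + (2γ/T) ∫_{0<s≤t} [(∫ p_0 K_s F dμ₀)² + (∫ p_N K_s F dμ₀)²] ds ≤ ∫ F² dμ₀`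

(lower Lebesgue integral in `s`): the `C_c` budget `forecastBudget_timeResolved_smooth_le` extended by density and
the `L²(μ₀)`-contraction of the equilibrium kernels. [folklore] -/
theorem forecastBudget_timeResolved_of_sq_integrable : ∀ ω₂ lam β γ : ℝ, 0 < ω₂ → 0 ≤ lam → 0 < β → 0 < γ → ∀ T : ℝ, 0 < T → ∀ (N : ℕ) (F : PhaseSpace (N + 1) → ℝ), Measurable F → Integrable (fun z => F z ^ 2) ((pinnedChain ω₂ lam β γ).gibbsMeasure (N + 1) T) → ∀ t : ℝ, 0 < t → ENNReal.ofReal (∫ x, (∫ y, F y ∂((pinnedChain ω₂ lam β γ).transitionKernel (N + 1) T T t.toNNReal x)) ^ 2 ∂((pinnedChain ω₂ lam β γ).gibbsMeasure (N + 1) T)) + ENNReal.ofReal (2 * γ / T) * ∫⁻ s in Ioc (0 : ℝ) t, (ENNReal.ofReal ((∫ x, x.2 0 * (∫ y, F y ∂((pinnedChain ω₂ lam β γ).transitionKernel (N + 1) T T s.toNNReal x)) ∂((pinnedChain ω₂ lam β γ).gibbsMeasure (N + 1) T)) ^ 2) + ENNReal.ofReal ((∫ x, x.2 (Fin.last N)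 * (∫ y, F y ∂((pinnedChain ω₂ lam β γ).transitionKernel (N + 1) T T s.toNNReal x)) ∂((pinnedChain ω₂ lam β γ).gibbsMeasure (N + 1) T)) ^ 2)) ≤ ENNReal.ofReal (∫ x, F x ^ 2 ∂((pinnedChain ω₂ lam β γ).gibbsMeasure (N + 1) T)) :=
  fun _ _ _ _ hω hl hβ hγ _ hT N _ hFm hF2 _ ht =>
    forecastBudget_timeResolved_of_sq_integrable' hω hl hβ hγ hT N hFm hF2 ht

end Summit.AtomisticToContinuum.FouriersLaw.Theorems.PhononMeanFreePath

end
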